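import Summits.QuantumFields.BalabanUV.Beta.SymmetrisedAxialReflection
import Summits.QuantumFields.BalabanUV.Beta.AxialProjectorBlockMean

/-!
# `BalabanUV.Beta.SymmetrisedAxialGaugeBlockMean` — binder row D1, RULING R-D1-g25-1 step S1f: THE BLOCK-MEAN-NORMALISED SYMMETRISED AXIAL
# PROJECTOR `Π^{sym}_bm A := A − grad(g − blockMean g)`, `g = (d!)⁻¹·symTreeGaugeAt ρ A` — it PRESERVES the straight block averages
# (`contourSum (Π^{sym}_bm A) = contourSum A`), lands in the symmetrised slice, is the identity there, idempotent, and commutes with every axis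
# PERMUTATION and every centred axis REFLECTION (the dressing of JSB12SYM-SPINE v1 (Σ2); cf. the comb's `AxialProjectorBlockMean.axProjBmAt`)

HONEST FRAMING (cell contract, verbatim): «discharging `BetaPertH` makes Bałaban's UV stability UNCONDITIONAL — a real constructive-QFT
result; it is NOT the continuum limit and NOT the Clay problem.»  THIS MODULE DISCHARGES NOTHING of `BetaPertH` ∕ row D1: [folklore] finite sums
on `ℤ^d` (Form level).  0 sorry, 0 `def … : Prop`, nothing cited as a fact; quotations are OBJECT LOCATORS.

WHY the block-mean normalisation (as for the comb, an2 gen 11 ∕ `AxialProjectorBlockMean`): the straight block averages `contourSum` ([Balaban1984PropagatorsI]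
(1.11)) see a gauge transformation `grad λ` only through the block sums of `λ`; subtracting from the gauge parameter its block mean makes the projector
INVISIBLE to `contourSum` while (the block mean being constant on blocks) it still lands in the symmetrised slice — so the dressed resolvents of
JSB12SYM-SPINE (Σ2) keep the straight averaging constraint exactly (the input of the `RelInv` rules against the bordered Hessian `bhK`).
PROVED: `symAxProjBmAt_eq` (= `symAxProjAt` + grad of a block-constant function), `contourSum_symAxProjAt` (root normalisation breaks the straight
averages by `dz∘blockSum`), **`contourSum_symAxProjBmAt`** (block-mean normalisation preserves them), **`symAxialGaugeAt_symAxProjBmAt`**, `symAxProjBmAt_eq_self_of`,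
`symAxProjBmAt_idem`, and the covariances **`symAxProjBmAt_ctr_P1`** (every `π ∈ S_d`) and **`symAxProjBmAt_R1`** (`L` odd, every axis) — via
`blockMeanAt_P0`∕`blockMeanAt_R0`.  NOT HERE: the kernelisation `piKSymBm` (K1), `RelInv` (K2), tables, estimates.  NOT D1, NOT BetaPertH, NOT continuum, NOT Clay.
CHART (RULING R-D1-g25-4): chart (II) — the FIXED κ = 0 slice `ker G_sym` with the block-orthogonal `symE`; the slice-exchange row hSX
(`R_SX`, an3-g46 THEOREM R, `b2b-balaban-beta-an3/gen46/FP-SYM.v1.md`) is a SEPARATE displayed binder of the literal and is NOT in this file.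
HONEST DEPENDENCY (verbatim): «continuum YM on T⁴ ⇐ BetaPertH ∧ nine spine estimates (0/9 proved); BetaPertH ⇐ (D1) ∧ (D4) ∧ CAP+tail;
G-an2-4 gates asym, D1 and NE2/3/4.»  ABSOLUTE RULE (cell, verbatim): «No internally-minted statement may enter as a cited fact. Every
hypothesis is either kernel-proved in this package or a verbatim quotation of a PUBLISHED theorem with page reference.»
Unit `b2b-balaban-beta-an2` gen 25 (row-D1 owner), 2026-08-21.
-/

namespace Summit.QuantumFields.BalabanUV.Beta.SymmetrisedAxialGaugeBlockMean

noncomputable section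

open Finset
open scoped BigOperators Nat
open Literature.MathematicalPhysics.QuantumFieldTheory.Balaban1983to89.Beta
open AffineAveraging (Form0 Form1 Site unitVec dz box toSite blockSum contourSum contourSum_dz)
open AffineReproduction (contourSum_sub)
open AveragingContours (grad axial blk blk_block grad_eq_dz)
open AveragingContoursRooted (ctr ctrOff ctrOff_mem_box)
open ResolventReflection (sref R0 R1 R0_apply blockSum_R0 dz_R0)
open RootedComb (blk_sref grad_R0 R1_sub)
open Summit.QuantumFields.BalabanUV.Beta.KernelPermutation (psite psite_apply)
open Summit.QuantumFields.BalabanUV.Beta.ResolventPermutation (P0 P1 P0_apply P1_apply dz_P0 blockSum_P0)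
open Summit.QuantumFields.BalabanUV.Beta.AxialProjectorBlockMean (blockMeanAt grad_sub blockSum_sub_blockMeanAt blockMeanAt_blockConst)
open Summit.QuantumFields.BalabanUV.Beta.SymmetrisedAxialPotential
open Summit.QuantumFields.BalabanUV.Beta.SymmetrisedAxialGauge
open Summit.QuantumFields.BalabanUV.Beta.SymmetrisedAxialReflection

variable {d : ℕ}

/-! ## §1 The block-mean-normalised symmetrised gauge parameter and projector -/

/-- [our object] The normalised symmetrised tree gauge `g = (d!)⁻¹ · symTreeGaugeAt ρ A N` (the gauge parameter of S1d's `symAxProjAt`). -/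
def symGaugeAt (ρ : Site d) (A : Form1 d ℝ) (N : ℕ) : Form0 d ℝ := fun x => (d ! : ℝ)⁻¹ * symTreeGaugeAt ρ A N x

/-- [our object] The BLOCK-MEAN-NORMALISED parameter `g − blockMean g`. -/
def symBmGaugeAt (ρ : Site d) (A : Form1 d ℝ) (N : ℕ) : Form0 d ℝ := symGaugeAt ρ A N - blockMeanAt N (symGaugeAt ρ A N)

/-- [our object] **THE BLOCK-MEAN-NORMALISED SYMMETRISED AXIAL PROJECTOR** `Π^{sym}_bm A := A − grad (symBmGaugeAt ρ A N)`. -/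
def symAxProjBmAt (ρ : Site d) (N : ℕ) (A : Form1 d ℝ) : Form1 d ℝ := A - grad (symBmGaugeAt ρ A N)

/-- [folklore] S1d's projector in terms of `symGaugeAt`. -/
theorem symAxProjAt_eq_sub (ρ : Site d) (N : ℕ) (A : Form1 d ℝ) : symAxProjAt ρ N A = A - grad (symGaugeAt ρ A N) := rfl

/-- [folklore] `Π^{sym}_bm = Π^{sym} + grad (block mean of the parameter)`. -/
theorem symAxProjBmAt_eq (ρ : Site d) (N : ℕ) (A : Form1 d ℝ) :
    symAxProjBmAt ρ N A = symAxProjAt ρ N A + grad (blockMeanAt N (symGaugeAt ρ A N)) := by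
  unfold symAxProjBmAt symBmGaugeAt
  rw [grad_sub, symAxProjAt_eq_sub]
  abel

/-! ## §2 The straight block averages under the two projectors -/

/-- [folklore] **ROOT NORMALISATION BREAKS THE STRAIGHT AVERAGES**: `𝒬 (Π^{sym} A) = 𝒬 A − dz (blockSum g)`. -/
theorem contourSum_symAxProjAt (ρ : Site d) (N : ℕ) (A : Form1 d ℝ) :
    contourSum N (symAxProjAt ρ N A) = contourSum N A - dz (blockSum N (symGaugeAt ρ A N)) := by
  rw [symAxProjAt_eq_sub, contourSum_sub, grad_eq_dz, contourSum_dz]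

/-- [folklore] **BLOCK-MEAN NORMALISATION PRESERVES THE STRAIGHT AVERAGES**: `𝒬 (Π^{sym}_bm A) = 𝒬 A` (`N ≥ 1`). -/
theorem contourSum_symAxProjBmAt (ρ : Site d) {N : ℕ} (hN : 1 ≤ N) (A : Form1 d ℝ) :
    contourSum N (symAxProjBmAt ρ N A) = contourSum N A := by
  unfold symAxProjBmAt symBmGaugeAt
  rw [contourSum_sub, grad_eq_dz, contourSum_dz, blockSum_sub_blockMeanAt hN]
  have h0 : dz (0 : Form0 d ℝ) = 0 := by funext κ x; simp [dz]
  rw [h0, sub_zero]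

/-! ## §3 `Π^{sym}_bm` lands in the symmetrised slice and is the identity there -/

/-- [folklore] Inside one block the SYMMETRISED potential of the gradient of a block-constant function vanishes. -/
theorem symAxial_grad_blockConst {N : ℕ} {r : Fin d → ℕ} (hr : r ∈ box d N) (g : Form0 d ℝ) (hg : ∀ x, g x = g ((N : ℤ) • blk N x))
    (y : Site d) {b : Fin d → ℕ} (hb : b ∈ box d N) :
    symAxial (grad g) ((N : ℤ) • y + toSite r) ((N : ℤ) • y + toSite b) = 0 := by
  rw [symAxial_grad, hg ((N : ℤ) • y + toSite b), hg ((N : ℤ) • y + toSite r), blk_block y hb, blk_block y hr, sub_self, mul_zero]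

/-- [folklore] **`Π^{sym}_bm` LANDS IN THE SYMMETRISED SLICE** (in-block root): `SymAxialGaugeAt ρ (Π^{sym}_bm A) N`. -/
theorem symAxialGaugeAt_symAxProjBmAt {N : ℕ} (hN : 1 ≤ N) {r : Fin d → ℕ} (hr : r ∈ box d N) (A : Form1 d ℝ) :
    SymAxialGaugeAt (toSite r) (symAxProjBmAt (toSite r) N A) N := by
  intro y b hb
  rw [symAxProjBmAt_eq]
  have h1 := symAxialGaugeAt_symAxProjAt hr A y b hb
  have hsplit : symAxial (symAxProjAt (toSite r) N A + grad (blockMeanAt N (symGaugeAt (toSite r) A N))) ((N : ℤ) • y + toSite r) ((N : ℤ) • y + toSite b)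
      = symAxial (symAxProjAt (toSite r) N A) ((N : ℤ) • y + toSite r) ((N : ℤ) • y + toSite b)
        + symAxial (grad (blockMeanAt N (symGaugeAt (toSite r) A N))) ((N : ℤ) • y + toSite r) ((N : ℤ) • y + toSite b) := by
    have h := symAxial_sub (symAxProjAt (toSite r) N A + grad (blockMeanAt N (symGaugeAt (toSite r) A N)))
      (grad (blockMeanAt N (symGaugeAt (toSite r) A N))) ((N : ℤ) • y + toSite r) ((N : ℤ) • y + toSite b)
    rw [add_sub_cancel_right] at h
    linarith
  rw [hsplit, h1, zero_add]
  exact symAxial_grad_blockConst hr _ (fun x => blockMeanAt_blockConst N _ rfl hN x) y hb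

/-- [folklore] **`Π^{sym}_bm` IS THE IDENTITY ON THE SYMMETRISED SLICE** (in-block root). -/
theorem symAxProjBmAt_eq_self_of_symAxialGaugeAt {N : ℕ} (hN : 1 ≤ N) {r : Fin d → ℕ} {A : Form1 d ℝ}
    (hA : SymAxialGaugeAt (toSite r) A N) : symAxProjBmAt (toSite r) N A = A := by
  unfold symAxProjBmAt symBmGaugeAt
  have hg : symGaugeAt (toSite r) A N = 0 := by
    funext x
    rw [symGaugeAt, symTreeGaugeAt_eq_zero_of_symAxialGaugeAt hN hA]
    simp
  rw [hg]
  have h0 : blockMeanAt N (0 : Form0 d ℝ) = 0 := by funext x; simp [blockMeanAt, blockSum]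
  rw [h0, sub_zero]
  have hz : grad (0 : Form0 d ℝ) = 0 := by funext κ x; simp [grad]
  rw [hz, sub_zero]

/-- [folklore] **`Π^{sym}_bm` IS IDEMPOTENT** (in-block root). -/
theorem symAxProjBmAt_idem {N : ℕ} (hN : 1 ≤ N) {r : Fin d → ℕ} (hr : r ∈ box d N) (A : Form1 d ℝ) :
    symAxProjBmAt (toSite r) N (symAxProjBmAt (toSite r) N A) = symAxProjBmAt (toSite r) N A :=
  symAxProjBmAt_eq_self_of_symAxialGaugeAt hN (symAxialGaugeAt_symAxProjBmAt hN hr A)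

/-- [folklore] The symmetrised averaging of the projected field vs the original, through the decomposition `d!·𝒬 − dz∘SymLamAt` and
`contourSum_symAxProjBmAt` (any root; `N ≥ 1`). -/
theorem symLinAvgAt_symAxProjBmAt {N : ℕ} (hN : 1 ≤ N) (ρ : Site d) (A : Form1 d ℝ) (μ : Fin d) (y : Site d) :
    symLinAvgAt ρ (symAxProjBmAt ρ N A) N μ y
      = symLinAvgAt ρ A N μ y - dz (SymLamAt ρ (symAxProjBmAt ρ N A) N) μ y + dz (SymLamAt ρ A N) μ y := by
  rw [symLinAvgAt_eq_contourSum_sub_dz, symLinAvgAt_eq_contourSum_sub_dz, contourSum_symAxProjBmAt _ hN]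
  ring

/-- [folklore] … and the projected field's `SymLamAt` vanishes, so `symLinAvgAt ρ (Π^{sym}_bm A) = d!·𝒬 A`. -/
theorem symLinAvgAt_symAxProjBmAt_eq {N : ℕ} (hN : 1 ≤ N) {r : Fin d → ℕ} (hr : r ∈ box d N) (A : Form1 d ℝ) (μ : Fin d) (y : Site d) :
    symLinAvgAt (toSite r) (symAxProjBmAt (toSite r) N A) N μ y = (d ! : ℝ) * contourSum N A μ y := by
  rw [symLinAvgAt_eq_of_symAxialGaugeAt (symAxialGaugeAt_symAxProjBmAt hN hr A), contourSum_symAxProjBmAt _ hN]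

/-! ## §4 Covariance under axis permutations and centred axis reflections -/

/-- [folklore] `blockMeanAt` commutes with the axis permutation. -/
theorem blockMeanAt_P0 (π : Equiv.Perm (Fin d)) (N : ℕ) (f : Form0 d ℝ) : blockMeanAt N (P0 π f) = P0 π (blockMeanAt N f) := by
  funext x
  simp only [blockMeanAt, P0_apply, blockSum_P0, blk_psite]

/-- [folklore] `blockMeanAt` commutes with the axis reflections (`1 ≤ N`). -/
theorem blockMeanAt_R0 {N : ℕ} (hN : 1 ≤ N) (α : Fin d) (f : Form0 d ℝ) : blockMeanAt N (R0 α f) = R0 α (blockMeanAt N f) := by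
  funext x
  simp only [blockMeanAt, R0_apply, blockSum_R0, blk_sref hN]

/-- [folklore] At the centred root the normalised parameter is a permutation scalar. -/
theorem symGaugeAt_ctr_P1 (π : Equiv.Perm (Fin d)) (A : Form1 d ℝ) (N : ℕ) : symGaugeAt (ctr d N) (P1 π A) N = P0 π (symGaugeAt (ctr d N) A N) := by
  funext x
  rw [symGaugeAt, P0_apply, symGaugeAt, symTreeGaugeAt_ctr_P1]

/-- [folklore] At the centred root the normalised parameter is a reflection scalar (`L` odd). -/
theorem symGaugeAt_R1 {N : ℕ} (hN : Odd N) (α : Fin d) (A : Form1 d ℝ) : symGaugeAt (ctr d N) (R1 α A) N = R0 α (symGaugeAt (ctr d N) A N) := by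
  funext x
  rw [symGaugeAt, R0_apply, symGaugeAt, symTreeGaugeAt_R1 hN, R0_apply]

/-- [folklore] **`Π^{sym}_bm` COMMUTES WITH EVERY AXIS PERMUTATION** (centred root). -/
theorem symAxProjBmAt_ctr_P1 (π : Equiv.Perm (Fin d)) (N : ℕ) (A : Form1 d ℝ) :
    symAxProjBmAt (ctr d N) N (P1 π A) = P1 π (symAxProjBmAt (ctr d N) N A) := by
  unfold symAxProjBmAt symBmGaugeAt
  rw [symGaugeAt_ctr_P1, blockMeanAt_P0, P1_sub]
  have h : P0 π (symGaugeAt (ctr d N) A N) - P0 π (blockMeanAt N (symGaugeAt (ctr d N) A N))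
      = P0 π (symGaugeAt (ctr d N) A N - blockMeanAt N (symGaugeAt (ctr d N) A N)) := rfl
  rw [h, ← P1_grad]

/-- [folklore] **`Π^{sym}_bm` COMMUTES WITH EVERY CENTRED AXIS REFLECTION** (`L` odd). -/
theorem symAxProjBmAt_R1 {N : ℕ} (hN : Odd N) (α : Fin d) (A : Form1 d ℝ) :
    symAxProjBmAt (ctr d N) N (R1 α A) = R1 α (symAxProjBmAt (ctr d N) N A) := by
  unfold symAxProjBmAt symBmGaugeAt
  rw [symGaugeAt_R1 hN, blockMeanAt_R0 hN.pos, R1_sub]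
  have h : R0 α (symGaugeAt (ctr d N) A N) - R0 α (blockMeanAt N (symGaugeAt (ctr d N) A N))
      = R0 α (symGaugeAt (ctr d N) A N - blockMeanAt N (symGaugeAt (ctr d N) A N)) := rfl
  rw [h, grad_R0]

end

end Summit.QuantumFields.BalabanUV.Beta.SymmetrisedAxialGaugeBlockMean
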